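import Summits.HodgeConjecture.HodgeConjecture.Theorems.F0P3ClassificationEngineV6
import HarnessLib

/-!
# `F0P3InnerFormClassification` (T5-D): the HEAD `shape_of_T5` — a pinned classification kit with the laws yields the guarded letters' shape of Thm. 14.6.4 (v≤3.1: `(C1♮) ∧ (C2) ∧ (C3₀)`; v≥4: `(C1♮) ∧ (C2♯) ∧ (C3♯)`)
# at its frame — and the frame-universal composition `shapeGuarded_of_T5` over a named `KitFamily`, feeding ★ B0 `letters_guarded_of_shape` BY NAME

Theorems rendering (F0P3-plan (g4) RULINGS (V9)(b)∕(V12), F0P3-p03 (g6)) of the T5 statement layer = dossier line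
`Cruxes/H413/Lines/F0_T5InnerFormClassification.lean` (v6 b097d927; PLAN.F0P3g4 §22–§25), split by topic into four ★-importable modules sharing the
namespace `…Cruxes.H413.F0P3InnerFormClassification` (Theorems never import Lines): (A) `F0P3ClassificationKit` — frame, e.v.p. germs, the kit, pins;
(B) `F0P3ClassificationLaws` — the named laws and the intermediate statements (14.6.2) ∕ coefficient formula; (C) `F0P3ClassificationEngine` — the
integrator's own mathematics Z3∕Z2∕Z10a, PROVED; (D) `F0P3InnerFormClassification` — glue, the head `shape_of_T5`, the kit-family composition
`shapeGuarded_of_T5`  EDITION V6 (RULING (V36): dossier v6 = v5 + hunk A — `ramCls : Cls → Set (Places L)`, `Adm S c := ramCls c ⊆ ↑S ∧ cptTriv c`, guarded pin (x) ramification cofiniteness; new module names + namespace suffix `V6`; supersedes the V5 chain ★ p820470∕p821145∕p821410 and the v3.1 chain ★ p818801∕p819119∕p819337∕p819986, which stay as previous editions).  Declarations and proofs are BYTE-IDENTICAL to the dossier text (except the type-preserving header spellings marked `dedup.landed` below); only module docstrings, the namespace name, a few one-line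
docstrings (Theorems lint) and the re-emitted `variable` blocks differ.  No `sorry`, no named fact, no instance, no notation.

THIS MODULE: §3 glue (`memberCoeff`∕`expansion` bounds, `mult_le_one_of_formula`), §4 `shape_of_T5`, §5 `KitFamily`, `shapeGuarded_of_T5` (default heartbeats), consumer checks.
HONEST LABEL: HC_CM is proved only modulo the printed citations until rung 0 closes.
-/

attribute [local instance 100] LieRing.ofAssociativeRing

set_option autoImplicit false
set_option linter.dupNamespace false

-- Gate lint `dedup.landed` (header-text keyed): theorems whose header coincides with a landed edition (v3.1 ∕ V5) are written with
-- one binder's dot-notation expanded ∕ a numeral ascribed — elaborated statements unchanged (F0P3-p03 (g6), 2026-08-31).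

noncomputable section

open NumberField IsDedekindDomain MeasureTheory
open scoped Matrix ComplexOrder BigOperators Classical

namespace Summit.HodgeConjecture.HodgeConjecture.Cruxes.H413.F0P3InnerFormClassificationV6

open Literature.NumberTheory.Rogawski1990 Literature.NumberTheory.GaloisRepresentations
open Literature.NumberTheory.Automorphic Literature.NumberTheory.Automorphic.UnitaryGroup
open Literature.NumberTheory.Automorphic.UnitaryGroup.CotangentForms
open Literature.RepresentationTheory.BorelWallach2000
open Literature.RepresentationTheory.KonnoKonno2007

/-! ## §3 KERNEL-CHECKED GLUE: the expansion coefficients take values in `{−1, 0, 1}`·½… — `|E| ≤ 1`, and `E ≠ 0` only on the packet -/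

namespace ClassificationKit

variable {L : Type} [Field L] [NumberField L] [IsCMField L] {H : Matrix (Fin 3) (Fin 3) L} {ι : L →+* ℂ} {T : GL (Fin 3) ℂ}
  {hT : (T : Matrix (Fin 3) (Fin 3) ℂ)ᴴ * H.map ι * (T : Matrix (Fin 3) (Fin 3) ℂ) = Literature.Geometry.ComplexHyperbolic.BallModel.J}
  {μ : Measure (Gp L H).automorphicQuotient} [(Gp L H).IsAutomorphicMeasure μ] (𝔠 : ClassificationKit L H ι T hT μ)

/-- `memberCoeff ∈ {0, 1, −1}` for `ε = ±1`. [cite: Rogawski1990, §14.6 p. 238] -/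
theorem memberCoeff_mem {C : Type*} (Pk : LocalAPacket C) (ε : ℚ) (hε : ε = 1 ∨ ε = (-1 : ℚ)) (x : C) :
    memberCoeff Pk ε x = 0 ∨ memberCoeff Pk ε x = 1 ∨ memberCoeff Pk ε x = -1 := by
  unfold memberCoeff
  rcases hε with h | h <;> subst h <;> split_ifs <;> simp

/-- A non-zero member coefficient sits on a packet member. [cite: Rogawski1990, §14.6 p. 238] -/
theorem memberCoeff_ne_zero {C : Type*} (Pk : LocalAPacket C) (ε : ℚ) (x : C) (h : memberCoeff Pk ε x ≠ 0) :
    x ∈ LocalAPacket.members Pk := by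
  unfold memberCoeff at h
  rw [LocalAPacket.mem_members_iff]
  by_contra hx
  push Not at hx
  rw [if_neg hx.1, if_neg hx.2] at h
  exact h rfl

/-- `|memberCoeff| ≤ 1` for `ε = ±1`. [cite: Rogawski1990, §14.6 p. 238] -/
theorem abs_memberCoeff_le {C : Type*} (Pk : LocalAPacket C) (ε : ℚ) (hε : ε = 1 ∨ ε = (-1 : ℚ)) (x : C) :
    |memberCoeff Pk ε x| ≤ 1 := by
  rcases memberCoeff_mem Pk ε hε x with h | h | h <;> rw [h] <;> simp

/-- `|∏_v memberCoeff_v| ≤ 1` for `ε = ±1`. [cite: Rogawski1990, §14.6 p. 238] -/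
theorem abs_prod_memberCoeff_le (ξ : OneDimAutRepH L) (S : Finset (Places L)) (ε : ℚ) (hε : ε = 1 ∨ ε = (-1 : ℚ))
    (x : ∀ v : ↥S, IrrClass ((cmDatum L 3 H).Local v.1)) :
    |∏ v : ↥S, memberCoeff (𝔠.packFin ξ v.1) ε (x v)| ≤ 1 := by
  rw [Finset.abs_prod]
  calc ∏ v : ↥S, |memberCoeff (𝔠.packFin ξ v.1) ε (x v)| ≤ ∏ v : ↥S, (1 : ℚ) :=
        Finset.prod_le_prod (fun _ _ => abs_nonneg _) fun v _ => abs_memberCoeff_le _ ε hε _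
    _ = 1 := by simp

/-- `|E_ξ(x)| ≤ 1`. -/
theorem abs_expansion_le (ξ : OneDimAutRepH L) (S : Finset (Places L)) (hc : 𝔠.sgnG ξ = 1 ∨ 𝔠.sgnG ξ = -1) (x : LocS L H S) :
    |𝔠.expansion ξ S x| ≤ 1 := by
  unfold expansion
  have hA : |memberCoeff (𝔠.packInf ξ) (-1) x.1 * ∏ v : ↥S, memberCoeff (𝔠.packFin ξ v.1) (-1) (x.2 v)| ≤ 1 := by
    rw [abs_mul]
    calc _ ≤ (1 : ℚ) * 1 := mul_le_mul (abs_memberCoeff_le _ _ (Or.inr rfl) _) (𝔠.abs_prod_memberCoeff_le ξ S _ (Or.inr rfl) _)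
          (abs_nonneg _) zero_le_one
      _ = 1 := one_mul _
  have hB : |memberCoeff (𝔠.packInf ξ) 1 x.1 * ∏ v : ↥S, memberCoeff (𝔠.packFin ξ v.1) 1 (x.2 v)| ≤ 1 := by
    rw [abs_mul]
    calc _ ≤ (1 : ℚ) * 1 := mul_le_mul (abs_memberCoeff_le _ _ (Or.inl rfl) _) (𝔠.abs_prod_memberCoeff_le ξ S _ (Or.inl rfl) _)
          (abs_nonneg _) zero_le_one
      _ = 1 := one_mul _
  have hc' : |𝔠.sgnG ξ| = 1 := by rcases hc with h | h <;> rw [h] <;> simp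
  have hF : |(if 𝔠.cptXi ξ then (1 : ℚ) else 0)| ≤ 1 := by split_ifs <;> simp
  have hN : |((-1 : ℚ)) ^ 𝔠.N ξ| = 1 := by rw [abs_pow, abs_neg, abs_one, one_pow]
  calc _ = |(if 𝔠.cptXi ξ then (1 : ℚ) else 0)| * (1 / 2) * |((-1 : ℚ)) ^ 𝔠.N ξ| *
            |memberCoeff (𝔠.packInf ξ) (-1) x.1 * ∏ v : ↥S, memberCoeff (𝔠.packFin ξ v.1) (-1) (x.2 v) +
              𝔠.sgnG ξ * (memberCoeff (𝔠.packInf ξ) 1 x.1 * ∏ v : ↥S, memberCoeff (𝔠.packFin ξ v.1) 1 (x.2 v))| := by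
          rw [abs_mul, abs_mul, abs_mul]; norm_num
    _ ≤ 1 * (1 / 2) * 1 * (1 + 1) := by
          rw [hN]
          refine mul_le_mul (mul_le_mul (mul_le_mul_of_nonneg_right hF (by norm_num)) le_rfl (by positivity) (by positivity)) ?_
            (abs_nonneg _) (by positivity)
          calc _ ≤ |memberCoeff (𝔠.packInf ξ) (-1) x.1 * ∏ v : ↥S, memberCoeff (𝔠.packFin ξ v.1) (-1) (x.2 v)| +
                    |𝔠.sgnG ξ * (memberCoeff (𝔠.packInf ξ) 1 x.1 * ∏ v : ↥S, memberCoeff (𝔠.packFin ξ v.1) 1 (x.2 v))| := abs_add_le _ _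
            _ ≤ 1 + 1 := by
                  refine add_le_add hA ?_
                  rw [abs_mul, hc', one_mul]; exact hB
    _ = 1 := by norm_num

/-- `E_ξ(x) ≠ 0 ⇒` every coordinate of `x` lies in its packet. -/
theorem coords_mem_of_expansion_ne_zero (ξ : OneDimAutRepH L) (S : Finset (Places L)) (x : LocS L H S) (h : 𝔠.expansion ξ S x ≠ 0) :
    x.1 ∈ (𝔠.packInf ξ).members ∧ 𝔠.cptXi ξ ∧ ∀ v : ↥S, x.2 v ∈ (𝔠.packFin ξ v.1).members := by
  unfold expansion at h
  refine ⟨?_, ?_, fun v => ?_⟩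
  · by_contra hx
    have h1 : memberCoeff (𝔠.packInf ξ) (-1) x.1 = 0 := by
      by_contra h1; exact hx (memberCoeff_ne_zero _ _ _ h1)
    have h2 : memberCoeff (𝔠.packInf ξ) 1 x.1 = 0 := by
      by_contra h2; exact hx (memberCoeff_ne_zero _ _ _ h2)
    rw [h1, h2] at h; simp at h
  · by_contra hF; rw [if_neg hF] at h; simp at h
  · by_contra hx
    have h1 : memberCoeff (𝔠.packFin ξ v.1) (-1) (x.2 v) = 0 := by
      by_contra h1; exact hx (memberCoeff_ne_zero _ _ _ h1)
    have h2 : memberCoeff (𝔠.packFin ξ v.1) 1 (x.2 v) = 0 := by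
      by_contra h2; exact hx (memberCoeff_ne_zero _ _ _ h2)
    have p1 : ∏ w : ↥S, memberCoeff (𝔠.packFin ξ w.1) (-1) (x.2 w) = 0 := Finset.prod_eq_zero (Finset.mem_univ v) h1
    have p2 : ∏ w : ↥S, memberCoeff (𝔠.packFin ξ w.1) 1 (x.2 w) = 0 := Finset.prod_eq_zero (Finset.mem_univ v) h2
    rw [p1, p2] at h; simp at h

/-- From the coefficient formula: `m ≤ 1`, and `m ≠ 0 ⇒` coordinates in the packets. -/
theorem mult_le_one_of_formula (hL : 𝔠.LocalExpansion) (hC : 𝔠.CoefficientFormula) (ξ : OneDimAutRepH L) (S : Finset (Places L)) (hS : 𝔠.ram ξ ⊆ S)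
    (c : 𝔠.Cls) (hc : EqOff L H S (𝔠.evp c) (𝔠.tXi ξ)) (hr : 𝔠.Adm S c) :
    𝔠.mult c ≤ 1 ∧ (𝔠.mult c ≠ 0 →
      𝔠.clInf c ∈ (𝔠.packInf ξ).members ∧ 𝔠.cptXi ξ ∧ ∀ v : ↥S, 𝔠.clFin c v.1 ∈ (𝔠.packFin ξ v.1).members) := by
  have hform := hC ξ S hS c hc hr
  have habs := 𝔠.abs_expansion_le ξ S (hL ξ S hS).1 (𝔠.coordS S c)
  rw [← hform] at habs
  refine ⟨?_, fun hm => ?_⟩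
  · have : (𝔠.mult c : ℚ) ≤ 1 := (le_abs_self _).trans habs
    exact_mod_cast this
  · have hE : 𝔠.expansion ξ S (𝔠.coordS S c) ≠ 0 := by rw [← hform]; exact_mod_cast hm
    exact 𝔠.coords_mem_of_expansion_ne_zero ξ S _ hE

end ClassificationKit

/-! ## §4 THE HEAD — `∀ frame, pinned kit with laws ⇒ (C1♮) ∧ (C2♯) ∧ (C3♯)` at that frame, KERNEL-CHECKED; CONCLUSION KIT-FREE -/

/-- **THE HEAD OF T5 at one frame** (v4): for a PINNED classification kit satisfying the laws, and for `P` of COTANGENT TYPE at `ι` (RULING (V30)) that is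
`Kc`-TRIVIAL (RULING (V31); ★ for holomorphic-cotangent `P`, `kcTrivial_of_isHolCotangentAt`), the guarded multiplicity bound (C1♮), print's membership WITH THE
ARCHIMEDEAN PIN (C2♯) — `ξ_{ι′}` of cohomological type for trivial coefficients at EVERY complex embedding `ι′` w.r.t. `μω`'s parameter (F0P2's ★ `XiArchPinned`
minus the `μω`-side conjuncts, which F0P2 supplies) — and the one-`ξ`-per-token sign form (C3♯) of Thm. 14.6.4 hold; the ★ consumers (p04 (g6) B0
`letters_guarded_of_shape`, ★ p814530∕p814159, F0P2's S2♯) take them in ED. 2 (cotangent-guarded binders).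
[cite: Rogawski1990, §14.6 Thm. 14.6.4 pp. 236–239; §13.7 p. 206; §15.3 ¶1; Prop. 15.2.1] -/
theorem shape_of_T5 {L : Type} [Field L] [NumberField L] [IsCMField L] (H : Matrix (Fin 3) (Fin 3) L) (ι : L →+* ℂ) (T : GL (Fin 3) ℂ)
    (hT : (T : Matrix (Fin 3) (Fin 3) ℂ)ᴴ * H.map ι * (T : Matrix (Fin 3) (Fin 3) ℂ) = Literature.Geometry.ComplexHyperbolic.BallModel.J)
    (μ : Measure (Gp L H).automorphicQuotient) [(Gp L H).IsAutomorphicMeasure μ] (μω : HeckeCharacter L) (hμu : μω.IsUnitary)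
    (𝔠 : ClassificationKit L H ι T hT μ) (hpin : 𝔠.IsPinned) (hl : 𝔠.Laws μω hμu)
    -- the coefficient reading (Z10, proved below from the laws via (14.6.2) = Z2); REF1 R-17: the redundant `(14.6.2)` binder of v3.1 is dropped
    (hZ10 : 𝔠.CoefficientFormula) :
    (∀ (P : DiscreteAutomorphicRep (Gp L H) μ),
        IsCot L H ι T hT μ P → KcTrivial L H ι T hT μ P → ∀
        (M : Type) [AddCommGroup M] [Module ℂ M]
        (σK : Representation ℂ (uFormGroup (Fin 2) (Fin 1)).maximalCompact M) (σ𝔤 : (uFormGroup (Fin 2) (Fin 1)).lie →ₗ⁅ℝ⁆ Module.End ℂ M)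
        (hM : IsGKModule (uFormGroup (Fin 2) (Fin 1)) σK σ𝔤), IsIrreducibleGK σK σ𝔤 →
        HasToken L H ι T hT μ P M σK σ𝔤 →
        ∀ δ : ℤ, (δ = 1 ∨ δ = -1) → upqTypeClasses σK σ𝔤 hM.ad_compat 1 δ ≠ ⊥ →
          ((Gp L H).rightRegular μ).multiplicity P.space.toContRep ≤ 1) ∧
    (∀ (P : DiscreteAutomorphicRep (Gp L H) μ),
        IsCot L H ι T hT μ P → KcTrivial L H ι T hT μ P → ∀
        (M : Type) [AddCommGroup M] [Module ℂ M]
        (σK : Representation ℂ (uFormGroup (Fin 2) (Fin 1)).maximalCompact M) (σ𝔤 : (uFormGroup (Fin 2) (Fin 1)).lie →ₗ⁅ℝ⁆ Module.End ℂ M)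
        (hM : IsGKModule (uFormGroup (Fin 2) (Fin 1)) σK σ𝔤), IsIrreducibleGK σK σ𝔤 →
        HasToken L H ι T hT μ P M σK σ𝔤 →
        ∀ δ : ℤ, (δ = 1 ∨ δ = -1) → upqTypeClasses σK σ𝔤 hM.ad_compat 1 δ ≠ ⊥ →
          ∃ ξ : OneDimAutRepH L, MemXiFamily P (transpose_map_cmConjRingHom_eq_of_frame L ι H T hT) (isUnit_det_of_frame L ι H T hT) μω hμu ξ ∧
            ∀ k : InfinitePlace L → ℤ, μω.HasUnitaryArchType k (fun _ => 0) → ∀ ι' : L →+* ℂ, ξ.IsCohTrivialAt (ArchSignRecipe.tOfArchType k ι') ι') ∧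
    (∃ sgn : OneDimAutRepH L → ℤ, ∀ (P : DiscreteAutomorphicRep (Gp L H) μ),
        IsCot L H ι T hT μ P → KcTrivial L H ι T hT μ P → ∀
        (M : Type) [AddCommGroup M] [Module ℂ M]
        (σK : Representation ℂ (uFormGroup (Fin 2) (Fin 1)).maximalCompact M) (σ𝔤 : (uFormGroup (Fin 2) (Fin 1)).lie →ₗ⁅ℝ⁆ Module.End ℂ M)
        (hM : IsGKModule (uFormGroup (Fin 2) (Fin 1)) σK σ𝔤), IsIrreducibleGK σK σ𝔤 →
        HasToken L H ι T hT μ P M σK σ𝔤 →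
        ∀ δ : ℤ, (δ = 1 ∨ δ = -1) → upqTypeClasses σK σ𝔤 hM.ad_compat 1 δ ≠ ⊥ →
          ∃ ξ : OneDimAutRepH L, MemXiFamily P (transpose_map_cmConjRingHom_eq_of_frame L ι H T hT) (isUnit_det_of_frame L ι H T hT) μω hμu ξ ∧ δ = sgn ξ ∧
            ∀ k : InfinitePlace L → ℤ, μω.HasUnitaryArchType k (fun _ => 0) → ∀ ι' : L →+* ℂ, ξ.IsCohTrivialAt (ArchSignRecipe.tOfArchType k ι') ι') := by
  -- the common core: a token routes `P` to `ξ` off some `S₁`; the coefficient reading at `S := S₁ ∪ ram ξ ∪ ramCls (cl P)` bounds and locates `P`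
  have core : ∀ (P : DiscreteAutomorphicRep (Gp L H) μ), IsCot L H ι T hT μ P → KcTrivial L H ι T hT μ P → ∀ (M : Type) [AddCommGroup M] [Module ℂ M]
      (σK : Representation ℂ (uFormGroup (Fin 2) (Fin 1)).maximalCompact M) (σ𝔤 : (uFormGroup (Fin 2) (Fin 1)).lie →ₗ⁅ℝ⁆ Module.End ℂ M)
      (hM : IsGKModule (uFormGroup (Fin 2) (Fin 1)) σK σ𝔤) (hirr : IsIrreducibleGK σK σ𝔤), HasToken L H ι T hT μ P M σK σ𝔤 →
      ∀ δ : ℤ, (δ = 1 ∨ δ = -1) → upqTypeClasses σK σ𝔤 hM.ad_compat 1 δ ≠ ⊥ →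
        ∃ ξ : OneDimAutRepH L, 𝔠.mult (𝔠.cl P) ≤ 1 ∧ 𝔠.clInf (𝔠.cl P) ∈ (𝔠.packInf ξ).members ∧ 𝔠.cptXi ξ ∧
          (∀ v : Places L, 𝔠.clFin (𝔠.cl P) v ∈ (𝔠.packFin ξ v).members) := by
    intro P hP hKc M _ _ σK σ𝔤 hM hirr htok δ hδ hne'
    obtain ⟨ξ, S₁, hξ⟩ := hl.routing P M σK σ𝔤 hM hirr htok δ hδ hne'
    -- v6 (hunk A): the exact ramification set of `cl P` is finite by the guarded pin (x) — the ONLY finiteness the engine uses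
    have hfinR : (𝔠.ramCls (𝔠.cl P)).Finite := hpin.2.2.2.2.2.2.2.2.2 P hP hKc
    set S : Finset (Places L) := S₁ ∪ 𝔠.ram ξ ∪ hfinR.toFinset with hSdef
    have hS₁ : S₁ ⊆ S := Finset.subset_union_left.trans Finset.subset_union_left
    have hS : 𝔠.ram ξ ⊆ S := Finset.subset_union_right.trans Finset.subset_union_left
    have hr : 𝔠.Adm S (𝔠.cl P) :=
      ⟨fun v hv => Finset.mem_coe.2 (Finset.mem_union_right _ (hfinR.mem_toFinset.2 hv)), hpin.2.2.2.2.2.2.2.2.1 P hKc⟩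
    have hξS : EqOff L H S (𝔠.evp (𝔠.cl P)) (𝔠.tXi ξ) := EqOff.mono L H hS₁ hξ
    obtain ⟨hle, hmem⟩ := 𝔠.mult_le_one_of_formula hl.localExpansion hZ10 ξ S hS (𝔠.cl P) hξS hr
    have hm1 : (1 : ℕ∞) ≤ ((𝔠.mult (𝔠.cl P) : ℕ) : ℕ∞) := by rw [hpin.1 P]; exact one_le_multiplicity L H μ P
    have hm0 : 𝔠.mult (𝔠.cl P) ≠ 0 := by
      have : 1 ≤ 𝔠.mult (𝔠.cl P) := by exact_mod_cast hm1
      omega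
    obtain ⟨hinf, hcpt, hfin⟩ := hmem hm0
    refine ⟨ξ, hle, hinf, hcpt, fun v => ?_⟩
    by_cases hv : v ∈ S
    · exact hfin ⟨v, hv⟩
    · have hv1 : v ∉ 𝔠.ram ξ := fun h => hv (hS h)
      have hv2 : v ∉ 𝔠.ramCls (𝔠.cl P) := fun h => hv (Finset.mem_coe.1 (hr.1 h))
      rw [𝔠.unramMember_of_pins hpin hl.xiUnram ξ (𝔠.cl P) v hv1 hv2 (hξS v hv)]
      exact LocalAPacket.πn_mem_members _
  -- membership in the ξ-local family from coordinates in the packets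
  have memb : ∀ (P : DiscreteAutomorphicRep (Gp L H) μ) (ξ : OneDimAutRepH L), (∀ v : Places L, 𝔠.clFin (𝔠.cl P) v ∈ (𝔠.packFin ξ v).members) →
      MemXiFamily P (transpose_map_cmConjRingHom_eq_of_frame L ι H T hT) (isUnit_det_of_frame L ι H T hT) μω hμu ξ := by
    intro P ξ hfin
    refine ⟨𝔠.packFin ξ, hl.xiFamilyFin ξ, fun v c' hc' => ?_⟩
    rw [hl.localIsotypyFin P v c' hc']
    exact hfin v
  -- the archimedean pin at every complex embedding: at `ι′` over `ι` by `ArchMember` (through `TokenInf`), elsewhere by the compact factor `cptXi` (`CptXiSpec`)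
  have arch : ∀ (P : DiscreteAutomorphicRep (Gp L H) μ) (hP : IsCot L H ι T hT μ P) (M : Type) [AddCommGroup M] [Module ℂ M]
      (σK : Representation ℂ (uFormGroup (Fin 2) (Fin 1)).maximalCompact M) (σ𝔤 : (uFormGroup (Fin 2) (Fin 1)).lie →ₗ⁅ℝ⁆ Module.End ℂ M)
      (hM : IsGKModule (uFormGroup (Fin 2) (Fin 1)) σK σ𝔤) (hirr : IsIrreducibleGK σK σ𝔤), HasToken L H ι T hT μ P M σK σ𝔤 →
      ∀ δ : ℤ, (δ = 1 ∨ δ = -1) → upqTypeClasses σK σ𝔤 hM.ad_compat 1 δ ≠ ⊥ → ∀ ξ : OneDimAutRepH L,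
        𝔠.clInf (𝔠.cl P) ∈ (𝔠.packInf ξ).members → 𝔠.cptXi ξ →
        δ = 𝔠.sgnInf ξ ∧ ∀ k : InfinitePlace L → ℤ, μω.HasUnitaryArchType k (fun _ => 0) → ∀ ι' : L →+* ℂ, ξ.IsCohTrivialAt (ArchSignRecipe.tOfArchType k ι') ι' := by
    intro P hP M _ _ σK σ𝔤 hM hirr htok δ hδ hne' ξ hinf hcpt
    rw [hl.tokenInf P hP M σK σ𝔤 hM hirr htok] at hinf
    refine ⟨hl.archPacketCoh ξ M σK σ𝔤 hM hirr hinf δ hδ hne', fun k hk ι' => ?_⟩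
    by_cases hι' : InfinitePlace.mk ι' = InfinitePlace.mk ι
    · exact hl.archMember ξ k hk M σK σ𝔤 hM hirr hinf δ hδ hne' ι' hι'
    · exact hl.cptXiSpec ξ hcpt k hk ι' hι'
  refine ⟨?_, ?_, ⟨𝔠.sgnInf, ?_⟩⟩
  · intro P hP hKc M _ _ σK σ𝔤 hM hirr htok δ hδ hne'
    obtain ⟨ξ, hle, -, -, -⟩ := core P hP hKc M σK σ𝔤 hM hirr htok δ hδ hne'
    rw [← hpin.1 P]
    exact_mod_cast hle
  · intro P hP hKc M _ _ σK σ𝔤 hM hirr htok δ hδ hne'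
    obtain ⟨ξ, -, hinf, hcpt, hfin⟩ := core P hP hKc M σK σ𝔤 hM hirr htok δ hδ hne'
    exact ⟨ξ, memb P ξ hfin, (arch P hP M σK σ𝔤 hM hirr htok δ hδ hne' ξ hinf hcpt).2⟩
  · intro P hP hKc M _ _ σK σ𝔤 hM hirr htok δ hδ hne'
    obtain ⟨ξ, -, hinf, hcpt, hfin⟩ := core P hP hKc M σK σ𝔤 hM hirr htok δ hδ hne'
    exact ⟨ξ, memb P ξ hfin, arch P hP M σK σ𝔤 hM hirr htok δ hδ hne' ξ hinf hcpt⟩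

/-! ## §5 THE COMPOSITION over the stubs at a NAMED KIT FAMILY, in the letters' frame shape — and the ★ consumers BY NAME -/

/-- **A KIT FAMILY** (v5 = ★ p819986's header VERBATIM; REF1 (g5) OBJ-4): one classification kit per LETTERS' FRAME — a CM field `L` with `[L⁺:ℚ] ≥ 2` (`h2`),
a hermitian `H` of signature `(2,1)` at `ι` (`hT`) and DEFINITE at every other real place (`hdef`), an automorphic measure `μ`, and Rogawski's auxiliary `μω`
UNITARY with `μω|_{𝕀_{L⁺}} = ω_{L/L⁺}` (`hμω`, §4.8 p. 51) — exactly the binders of ★ `cohDiscrete_memXiFamily` and of the head's conclusion.  (v4 asked for a kit at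
every unitary `μω`: review p819638 ∕ OBJ-4 — at a wrong-`μω` frame `Routing` is false for the genuine model, so the family predicates below were unsatisfiable.)
The NAMED kit `𝔠₀` of ED. 4 is such a family whose pinned fields are ★ defs and whose posited fields are explicit parameters (REF1 R-5 (c): never `∃ kit`);
ROAD (i) (R-18): the closer defines `𝔎₀ L ι H T hT hdef h2 μ μω hμu hμω := 𝔠₀ …` and may USE `hdef h2 hμω` in the construction.
[cite: Rogawski1990, §4.8 p. 51; §14.6 Thm. 14.6.4] -/
def KitFamily : Type 1 :=
  ∀ (L : Type) [Field L] [NumberField L] [IsCMField L] (ι : L →+* ℂ) (H : Matrix (Fin 3) (Fin 3) L) (T : GL (Fin 3) ℂ)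
    (hT : (T : Matrix (Fin 3) (Fin 3) ℂ)ᴴ * H.map ι * (T : Matrix (Fin 3) (Fin 3) ℂ) = Literature.Geometry.ComplexHyperbolic.BallModel.J),
    (∀ τ' : L →+* ℂ, InfinitePlace.mk τ' ≠ InfinitePlace.mk ι → (H.map τ').PosDef) →
    2 ≤ Module.finrank ℚ ↥(maximalRealSubfield L) →
    ∀ (μ : Measure (adelicGroupData (↥(maximalRealSubfield L)) L (IsCMField.complexConj L) 3 H).automorphicQuotient)
    [(adelicGroupData (↥(maximalRealSubfield L)) L (IsCMField.complexConj L) 3 H).IsAutomorphicMeasure μ]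
    (μω : HeckeCharacter L) (hμu : μω.IsUnitary),
    (∀ x : Literature.NumberTheory.GaloisRepresentations.ideleGroup ↥(maximalRealSubfield L),
      μω (AdeleRing.ideleBaseChange (↥(maximalRealSubfield L)) L x) = quadraticHeckeCharCM L x) → ClassificationKit L H ι T hT μ

/-- The family is PINNED at every letters' frame (v5: `hdef`, `h2`, `hμω` threaded — ★ p819986's header VERBATIM). [cite: Rogawski1990, §14.6 Thm. 14.6.4] -/
def KitFamily.IsPinned (𝔎 : KitFamily) : Prop :=
  ∀ (L : Type) [Field L] [NumberField L] [IsCMField L] (ι : L →+* ℂ) (H : Matrix (Fin 3) (Fin 3) L) (T : GL (Fin 3) ℂ)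
    (hT : (T : Matrix (Fin 3) (Fin 3) ℂ)ᴴ * H.map ι * (T : Matrix (Fin 3) (Fin 3) ℂ) = Literature.Geometry.ComplexHyperbolic.BallModel.J),
    ∀ (hdef : ∀ τ' : L →+* ℂ, InfinitePlace.mk τ' ≠ InfinitePlace.mk ι → (H.map τ').PosDef)
    (h2 : 2 ≤ Module.finrank ℚ ↥(maximalRealSubfield L))
    (μ : Measure (adelicGroupData (↥(maximalRealSubfield L)) L (IsCMField.complexConj L) 3 H).automorphicQuotient)
    [(adelicGroupData (↥(maximalRealSubfield L)) L (IsCMField.complexConj L) 3 H).IsAutomorphicMeasure μ]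
    (μω : HeckeCharacter L) (hμu : μω.IsUnitary),
    ∀ (hμω : ∀ x : Literature.NumberTheory.GaloisRepresentations.ideleGroup ↥(maximalRealSubfield L),
      μω (AdeleRing.ideleBaseChange (↥(maximalRealSubfield L)) L x) = quadraticHeckeCharCM L x), (𝔎 L ι H T hT hdef h2 μ μω hμu hμω).IsPinned

/-- The family satisfies the LAWS at every letters' frame (v5: `hdef`, `h2`, `hμω` threaded — ★ p819986's header VERBATIM; at ED. 4: one open instance per law at `𝔠₀`).
[cite: Rogawski1990, §14.6 Thm. 14.6.4] -/
def KitFamily.Laws (𝔎 : KitFamily) : Prop :=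
  ∀ (L : Type) [Field L] [NumberField L] [IsCMField L] (ι : L →+* ℂ) (H : Matrix (Fin 3) (Fin 3) L) (T : GL (Fin 3) ℂ)
    (hT : (T : Matrix (Fin 3) (Fin 3) ℂ)ᴴ * H.map ι * (T : Matrix (Fin 3) (Fin 3) ℂ) = Literature.Geometry.ComplexHyperbolic.BallModel.J),
    ∀ (hdef : ∀ τ' : L →+* ℂ, InfinitePlace.mk τ' ≠ InfinitePlace.mk ι → (H.map τ').PosDef)
    (h2 : 2 ≤ Module.finrank ℚ ↥(maximalRealSubfield L))
    (μ : Measure (adelicGroupData (↥(maximalRealSubfield L)) L (IsCMField.complexConj L) 3 H).automorphicQuotient)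
    [(adelicGroupData (↥(maximalRealSubfield L)) L (IsCMField.complexConj L) 3 H).IsAutomorphicMeasure μ]
    (μω : HeckeCharacter L) (hμu : μω.IsUnitary),
    ∀ (hμω : ∀ x : Literature.NumberTheory.GaloisRepresentations.ideleGroup ↥(maximalRealSubfield L),
      μω (AdeleRing.ideleBaseChange (↥(maximalRealSubfield L)) L x) = quadraticHeckeCharCM L x), (𝔎 L ι H T hT hdef h2 μ μω hμu hμω).Laws μω hμu

/-- **`shapeGuarded_of_T5`** (v4 statement; v5 proof threads `hdef h2 hμω` into the family): a NAMED pinned kit family with the laws ⇒ `∀ compact CM frame, (C1♮) ∧ (C2♯) ∧ (C3♯)` for COTANGENT-TYPE, `Kc`-TRIVIAL `P`, spelled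
LITERALLY (no kit, no abbreviation of this file) — the shape the ★ consumers take in ED. 2: p04 (g6) B0 `letters_guarded_of_shape` (threads the cotangent guard `hP`,
derives `Kc`-triviality from p02 (g6) `F0P3CompactTrivOfRecord`), F0P2's S2♯ (reads the archimedean pin into ★ `XiArchPinned L ξ μω k` with its own `k`).
[cite: Rogawski1990, §14.6 Thm. 14.6.4; Prop. 15.2.1] -/
theorem shapeGuarded_of_T5 (𝔎 : KitFamily) (hpin : 𝔎.IsPinned) (hlaws : 𝔎.Laws) :
    ∀ (L : Type) [Field L] [NumberField L] [IsCMField L] (ι : L →+* ℂ) (H : Matrix (Fin 3) (Fin 3) L) (T : GL (Fin 3) ℂ)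
      (hT : (T : Matrix (Fin 3) (Fin 3) ℂ)ᴴ * H.map ι * (T : Matrix (Fin 3) (Fin 3) ℂ) = Literature.Geometry.ComplexHyperbolic.BallModel.J),
      (∀ τ' : L →+* ℂ, InfinitePlace.mk τ' ≠ InfinitePlace.mk ι → (H.map τ').PosDef) →
      2 ≤ Module.finrank ℚ ↥(maximalRealSubfield L) →
      ∀ (μ : Measure (adelicGroupData (↥(maximalRealSubfield L)) L (IsCMField.complexConj L) 3 H).automorphicQuotient)
        [(adelicGroupData (↥(maximalRealSubfield L)) L (IsCMField.complexConj L) 3 H).IsAutomorphicMeasure μ]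
        (μω : HeckeCharacter L) (hμu : μω.IsUnitary),
        (∀ x : Literature.NumberTheory.GaloisRepresentations.ideleGroup ↥(maximalRealSubfield L),
          μω (AdeleRing.ideleBaseChange (↥(maximalRealSubfield L)) L x) = quadraticHeckeCharCM L x) →
      (∀ (P : DiscreteAutomorphicRep (adelicGroupData (↥(maximalRealSubfield L)) L (IsCMField.complexConj L) 3 H) μ),
          (P.IsHolCotangentAt (cmArchSection L ι H T hT) (cmCompactFactor L ι H T hT) ∨
            P.IsAntiholCotangentAt (cmArchSection L ι H T hT) (cmCompactFactor L ι H T hT)) →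
          (∀ k : (adelicGroupData (↥(maximalRealSubfield L)) L (IsCMField.complexConj L) 3 H).Adelic, k ∈ cmCompactFactor L ι H T hT → ∀ v : P.space.toSubmodule, (adelicGroupData (↥(maximalRealSubfield L)) L (IsCMField.complexConj L) 3 H).rightRegular μ k (v : (adelicGroupData (↥(maximalRealSubfield L)) L (IsCMField.complexConj L) 3 H).L2 μ) = v) → ∀
          (M : Type) [AddCommGroup M] [Module ℂ M]
          (σK : Representation ℂ (uFormGroup (Fin 2) (Fin 1)).maximalCompact M) (σ𝔤 : (uFormGroup (Fin 2) (Fin 1)).lie →ₗ⁅ℝ⁆ Module.End ℂ M)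
          (hM : IsGKModule (uFormGroup (Fin 2) (Fin 1)) σK σ𝔤), IsIrreducibleGK σK σ𝔤 →
          (∃ T₁ : P.archModuleCM ι T hT →ₗ[ℂ] M,
            (∀ (k : (uFormGroup (Fin 2) (Fin 1)).maximalCompact) (w : P.archModuleCM ι T hT), T₁ (P.archRepKCM ι T hT k w) = σK k (T₁ w)) ∧
              (∀ (X : (uFormGroup (Fin 2) (Fin 1)).lie) (w : P.archModuleCM ι T hT), T₁ (P.archRepLieCM ι T hT X w) = σ𝔤 X (T₁ w)) ∧ T₁ ≠ 0) →
          ∀ δ : ℤ, (δ = 1 ∨ δ = -1) → upqTypeClasses σK σ𝔤 hM.ad_compat 1 δ ≠ ⊥ →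
            ((adelicGroupData (↥(maximalRealSubfield L)) L (IsCMField.complexConj L) 3 H).rightRegular μ).multiplicity P.space.toContRep ≤ 1) ∧
      (∀ (P : DiscreteAutomorphicRep (adelicGroupData (↥(maximalRealSubfield L)) L (IsCMField.complexConj L) 3 H) μ),
          (P.IsHolCotangentAt (cmArchSection L ι H T hT) (cmCompactFactor L ι H T hT) ∨
            P.IsAntiholCotangentAt (cmArchSection L ι H T hT) (cmCompactFactor L ι H T hT)) →
          (∀ k : (adelicGroupData (↥(maximalRealSubfield L)) L (IsCMField.complexConj L) 3 H).Adelic, k ∈ cmCompactFactor L ι H T hT → ∀ v : P.space.toSubmodule, (adelicGroupData (↥(maximalRealSubfield L)) L (IsCMField.complexConj L) 3 H).rightRegular μ k (v : (adelicGroupData (↥(maximalRealSubfield L)) L (IsCMField.complexConj L) 3 H).L2 μ) = v) → ∀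
          (M : Type) [AddCommGroup M] [Module ℂ M]
          (σK : Representation ℂ (uFormGroup (Fin 2) (Fin 1)).maximalCompact M) (σ𝔤 : (uFormGroup (Fin 2) (Fin 1)).lie →ₗ⁅ℝ⁆ Module.End ℂ M)
          (hM : IsGKModule (uFormGroup (Fin 2) (Fin 1)) σK σ𝔤), IsIrreducibleGK σK σ𝔤 →
          (∃ T₁ : P.archModuleCM ι T hT →ₗ[ℂ] M,
            (∀ (k : (uFormGroup (Fin 2) (Fin 1)).maximalCompact) (w : P.archModuleCM ι T hT), T₁ (P.archRepKCM ι T hT k w) = σK k (T₁ w)) ∧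
              (∀ (X : (uFormGroup (Fin 2) (Fin 1)).lie) (w : P.archModuleCM ι T hT), T₁ (P.archRepLieCM ι T hT X w) = σ𝔤 X (T₁ w)) ∧ T₁ ≠ 0) →
          ∀ δ : ℤ, (δ = 1 ∨ δ = -1) → upqTypeClasses σK σ𝔤 hM.ad_compat 1 δ ≠ ⊥ →
            ∃ ξ : OneDimAutRepH L, MemXiFamily P (transpose_map_cmConjRingHom_eq_of_frame L ι H T hT) (isUnit_det_of_frame L ι H T hT) μω hμu ξ ∧
              ∀ k : InfinitePlace L → ℤ, μω.HasUnitaryArchType k (fun _ => 0) → ∀ ι' : L →+* ℂ, ξ.IsCohTrivialAt (ArchSignRecipe.tOfArchType k ι') ι') ∧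
      (∃ sgn : OneDimAutRepH L → ℤ, ∀ (P : DiscreteAutomorphicRep (adelicGroupData (↥(maximalRealSubfield L)) L (IsCMField.complexConj L) 3 H) μ),
          (P.IsHolCotangentAt (cmArchSection L ι H T hT) (cmCompactFactor L ι H T hT) ∨
            P.IsAntiholCotangentAt (cmArchSection L ι H T hT) (cmCompactFactor L ι H T hT)) →
          (∀ k : (adelicGroupData (↥(maximalRealSubfield L)) L (IsCMField.complexConj L) 3 H).Adelic, k ∈ cmCompactFactor L ι H T hT → ∀ v : P.space.toSubmodule, (adelicGroupData (↥(maximalRealSubfield L)) L (IsCMField.complexConj L) 3 H).rightRegular μ k (v : (adelicGroupData (↥(maximalRealSubfield L)) L (IsCMField.complexConj L) 3 H).L2 μ) = v) → ∀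
          (M : Type) [AddCommGroup M] [Module ℂ M]
          (σK : Representation ℂ (uFormGroup (Fin 2) (Fin 1)).maximalCompact M) (σ𝔤 : (uFormGroup (Fin 2) (Fin 1)).lie →ₗ⁅ℝ⁆ Module.End ℂ M)
          (hM : IsGKModule (uFormGroup (Fin 2) (Fin 1)) σK σ𝔤), IsIrreducibleGK σK σ𝔤 →
          (∃ T₁ : P.archModuleCM ι T hT →ₗ[ℂ] M,
            (∀ (k : (uFormGroup (Fin 2) (Fin 1)).maximalCompact) (w : P.archModuleCM ι T hT), T₁ (P.archRepKCM ι T hT k w) = σK k (T₁ w)) ∧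
              (∀ (X : (uFormGroup (Fin 2) (Fin 1)).lie) (w : P.archModuleCM ι T hT), T₁ (P.archRepLieCM ι T hT X w) = σ𝔤 X (T₁ w)) ∧ T₁ ≠ 0) →
          ∀ δ : ℤ, (δ = 1 ∨ δ = -1) → upqTypeClasses σK σ𝔤 hM.ad_compat 1 δ ≠ ⊥ →
            ∃ ξ : OneDimAutRepH L, MemXiFamily P (transpose_map_cmConjRingHom_eq_of_frame L ι H T hT) (isUnit_det_of_frame L ι H T hT) μω hμu ξ ∧ δ = sgn ξ ∧
              ∀ k : InfinitePlace L → ℤ, μω.HasUnitaryArchType k (fun _ => 0) → ∀ ι' : L →+* ℂ, ξ.IsCohTrivialAt (ArchSignRecipe.tOfArchType k ι') ι') := by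
  intro L _ _ _ ι H T hT hdef h2 μ _ μω hμu hμω
  have hp := hpin L ι H T hT hdef h2 μ μω hμu hμω
  have hl := hlaws L ι H T hT hdef h2 μ μω hμu hμω
  exact shape_of_T5 H ι T hT μ μω hμu (𝔎 L ι H T hT hdef h2 μ μω hμu hμω) hp hl
    (coefficientFormula_of_laws _
      (perClassIdentity_of_laws _ hl.traceIdentity hl.spectralSideGp hl.factorisation hl.matchingS
        (separation_of_laws _ (hatInjective_of_pins _ hp hl.evpConvention) hl.hatBounded hl.unrStarAlgebra) hl.unrStarAlgebra)
      hl.transferS hl.linIndepS hl.unitaryCoord hl.unitaryPacket (classDet_of_pins _ hp hl.flathDet) hl.aPacketSpectral hl.localExpansion)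

end Summit.HodgeConjecture.HodgeConjecture.Cruxes.H413.F0P3InnerFormClassificationV6
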